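import Literature.Geometry.Lorentzian.ConnectionNaturality
import Literature.Geometry.Lorentzian.EinsteinProofs
import HarnessLib

/-!
# The Hessian and the wave operator of a composite `ζ ∘ u`

For a pseudo-Riemannian metric `g` (with its Levi-Civita connection), a real function `u` on the
manifold of class `C²` at `x` and `ζ : ℝ → ℝ` of class `C²` at `u x`:

* `mvfderiv_real_comp` — the chain rule `d(ζ ∘ u)_x = ζ'(u x) du_x`;
* `hessianAux_real_comp`, `hessian_real_comp` — **the Hessian of a composite**:
  `Hess(ζ ∘ u)_x(v, w) = ζ''(u x) du(v) du(w) + ζ'(u x) Hess u_x(v, w)`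
  (O'Neill 1983, Ch. 3, Def. 3.48–Lemma 3.49: `H^f(X,Y) = XYf − (∇_X Y)f`, with the product and
  chain rules);
* `trace_smulRight_dual` — the metric trace of the rank-one form `(v, w) ↦ α(v) β(w)`, namely
  `g⁻¹(α, β)` (linearity of the trace is `trace_add`/`trace_smul` of `EinsteinProofs.lean`);
* `dalembertian_real_comp` — **the wave / Laplace–Beltrami operator of a composite**:
  `□_g(ζ ∘ u)(x) = ζ''(u x) g⁻¹(du, du) + ζ'(u x) □_g u (x)` (trace of the previous identity;
  Gilbarg–Trudinger-type chain rule for `Δ`, e.g. the display in Schoen–Yau 1979, §2 after (2.2),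
  where it gives `Δφ ≤ 0` for the concave profile `ζ`);
* `innerDual_self_nonneg` — for a Riemannian `g`, `g⁻¹(α, α) ≥ 0`;
* `dalembertian_real_comp_nonpos` — hence **`□_g(ζ ∘ u) ≤ 0` when `ζ'' ≤ 0`, `ζ' ≥ 0` at `u x`
  and `□_g u (x) ≤ 0`** (the superharmonicity step (2.3) of Schoen–Yau 1979, §2 Step 1).

Everything is proved; no named facts are introduced.

## References

* B. O'Neill, *Semi-Riemannian geometry*, Academic Press 1983, Ch. 3, Def. 3.48–3.50,
  Lemma 3.49.
* R. Schoen, S.-T. Yau, *On the proof of the positive mass conjecture in general relativity*,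
  Comm. Math. Phys. 65 (1979), §2 Step 1, (2.2)–(2.3).
-/

noncomputable section

open Bundle Set Function Filter FiberBundle ContinuousLinearMap
open scoped Manifold ContDiff Topology

namespace Literature.Geometry.Lorentzian

namespace PseudoRiemannianMetric

variable {E : Type*} [NormedAddCommGroup E] [NormedSpace ℝ E] {H : Type*} [TopologicalSpace H]
  {I : ModelWithCorners ℝ E H} {M : Type*} [TopologicalSpace M] [ChartedSpace H M]
  [IsManifold I ∞ M] {n : ℕ∞ω} [Fact (1 ≤ n)] [FiniteDimensional ℝ E] [CompleteSpace E]
  (g : PseudoRiemannianMetric I n E (TangentSpace I : M → Type _))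

/-! ### The chain rule for real functions -/

omit [IsManifold I ∞ M] [Fact (1 ≤ n)] [FiniteDimensional ℝ E] [CompleteSpace E] in
/-- On the real line the manifold derivative is multiplication by the ordinary derivative:
`dζ_t(w) = ζ'(t) w` (both sides take the junk value consistently when `ζ` is not
differentiable). [folklore] -/
theorem mvfderiv_real_line (ζ : ℝ → ℝ) (t w : ℝ) :
    mvfderiv 𝓘(ℝ, ℝ) ζ t w = deriv ζ t * w := by
  simp only [mvfderiv, ContinuousLinearMap.comp_apply]
  rw [mfderiv_eq_fderiv]
  change fderiv ℝ ζ t w = deriv ζ t * w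
  rw [← toSpanSingleton_deriv, ContinuousLinearMap.toSpanSingleton_apply, smul_eq_mul, mul_comm]

omit [IsManifold I ∞ M] [Fact (1 ≤ n)] [FiniteDimensional ℝ E] [CompleteSpace E] in
/-- **Chain rule**: `d(ζ ∘ u)_x(v) = ζ'(u x) du_x(v)` for `u : M → ℝ` differentiable at `x` and
`ζ : ℝ → ℝ` differentiable at `u x`. [folklore] -/
theorem mvfderiv_real_comp {u : M → ℝ} {ζ : ℝ → ℝ} {x : M} (hζ : DifferentiableAt ℝ ζ (u x))
    (hu : MDifferentiableAt I 𝓘(ℝ, ℝ) u x) (v : TangentSpace I x) :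
    mvfderiv I (ζ ∘ u) x v = deriv ζ (u x) * mvfderiv I u x v := by
  have hζm : MDifferentiableAt 𝓘(ℝ, ℝ) 𝓘(ℝ, ℝ) ζ (u x) :=
    mdifferentiableAt_iff_differentiableAt.2 hζ
  rw [mvfderiv_comp_apply (I := 𝓘(ℝ, ℝ)) (I' := I) (f := ζ) (Φ := u) hζm hu v,
    mvfderiv_real_line ζ]
  rfl

/-! ### The Hessian of a composite -/

variable [g.HasLeviCivita]

omit [FiniteDimensional ℝ E] [CompleteSpace E] [Fact (1 ≤ n)] in
/-- **The Hessian operation of a composite.** For `u` of class `C²` at `x`, `ζ` of class `C²`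
at `u x`, and vector fields `X, Y` with `Y` differentiable at `x`:
`X(Y(ζ∘u))(x) − (∇_X Y)(ζ∘u)(x) = ζ''(u x) (Xu)(Yu)(x) + ζ'(u x) (X(Yu) − (∇_X Y)u)(x)` —
near `x`, `Y(ζ ∘ u) = (ζ' ∘ u) · Yu` (chain rule), then the product rule and the chain rule once
more. O'Neill 1983, Ch. 3, Lemma 3.49. [cite: ONeill1983, Ch. 3, Lemma 3.49] -/
theorem hessianAux_real_comp {u : M → ℝ} {ζ : ℝ → ℝ} {x : M} (hu : CMDiffAt 2 u x)
    (hζ : ContDiffAt ℝ 2 ζ (u x)) (X : Π y : M, TangentSpace I y) {Y : Π y : M, TangentSpace I y}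
    (hY : MDiffAt (T% Y) x) :
    g.hessianAux (ζ ∘ u) X Y x =
      deriv (deriv ζ) (u x) * (mvfderiv I u x (X x) * mvfderiv I u x (Y x))
        + deriv ζ (u x) * g.hessianAux u X Y x := by
  have hu1 : MDifferentiableAt I 𝓘(ℝ, ℝ) u x := hu.mdifferentiableAt (by norm_num)
  have hζ1 : DifferentiableAt ℝ ζ (u x) := hζ.differentiableAt (by norm_num)
  -- `ζ'` is differentiable at `u x`, `ζ` is differentiable near `u x`, `u` near `x`
  have hζ' : DifferentiableAt ℝ (deriv ζ) (u x) := by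
    have h := hζ.fderiv_right (m := 1) le_rfl
    have h1 : DifferentiableAt ℝ (fderiv ℝ ζ) (u x) := h.differentiableAt one_ne_zero
    have h2 : deriv ζ = fun t ↦ fderiv ℝ ζ t 1 := funext fun t ↦ fderiv_apply_one_eq_deriv.symm
    rw [h2]
    exact h1.clm_apply (differentiableAt_const _)
  have hζev : ∀ᶠ t in 𝓝 (u x), DifferentiableAt ℝ ζ t := by
    have h1 : ∀ᶠ t in 𝓝 (u x), ContDiffAt ℝ 2 ζ t := hζ.eventually (by simp)
    exact h1.mono fun t ht ↦ ht.differentiableAt (by norm_num)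
  have huev : ∀ᶠ y in 𝓝 x, MDifferentiableAt I 𝓘(ℝ, ℝ) u y := by
    have h1 : ∀ᶠ y in 𝓝 x, CMDiffAt 2 u y := (contMDiffAt_iff_contMDiffAt_nhds (by simp)).1 hu
    exact h1.mono fun y hy ↦ hy.mdifferentiableAt (by norm_num)
  have hcont : ContinuousAt u x := hu.continuousAt
  -- the inner function near `x`
  have heq : (fun y ↦ mvfderiv I (ζ ∘ u) y (Y y)) =ᶠ[𝓝 x]
      fun y ↦ deriv ζ (u y) * mvfderiv I u y (Y y) := by
    filter_upwards [huev, hcont.eventually hζev] with y hy hζy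
    exact mvfderiv_real_comp hζy hy (Y y)
  -- differentiability of the two factors at `x`
  have hF : MDifferentiableAt I 𝓘(ℝ, ℝ) (fun y ↦ mvfderiv I u y (Y y)) x :=
    mdifferentiableAt_mvfderiv_apply hu hY
  have hD : MDifferentiableAt I 𝓘(ℝ, ℝ) (fun y ↦ deriv ζ (u y)) x :=
    ((mdifferentiableAt_iff_differentiableAt.2 hζ').comp x hu1 :)
  -- the outer derivative
  have key := heq.mfderiv_eq (I := I) (I' := 𝓘(ℝ, ℝ))
  have h1 : mvfderiv I (fun y ↦ mvfderiv I (ζ ∘ u) y (Y y)) x (X x) =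
      mvfderiv I (fun y ↦ deriv ζ (u y) * mvfderiv I u y (Y y)) x (X x) := by
    change mfderiv I 𝓘(ℝ, ℝ) (fun y ↦ mvfderiv I (ζ ∘ u) y (Y y)) x (X x) =
      mfderiv I 𝓘(ℝ, ℝ) (fun y ↦ deriv ζ (u y) * mvfderiv I u y (Y y)) x (X x)
    rw [key]
    rfl
  have h2 : mvfderiv I (fun y ↦ deriv ζ (u y) * mvfderiv I u y (Y y)) x (X x) =
      deriv ζ (u x) * mvfderiv I (fun y ↦ mvfderiv I u y (Y y)) x (X x)
        + mvfderiv I u x (Y x) * mvfderiv I (fun y ↦ deriv ζ (u y)) x (X x) := by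
    rw [mvfderiv_fun_mul hD hF]
    simp only [_root_.add_apply, FunLike.coe_smul, Pi.smul_apply, smul_eq_mul]
  have h3 : mvfderiv I (fun y ↦ deriv ζ (u y)) x (X x) = deriv (deriv ζ) (u x) * mvfderiv I u x (X x) :=
    mvfderiv_real_comp (ζ := deriv ζ) hζ' hu1 (X x)
  simp only [hessianAux]
  rw [h1, h2, h3, mvfderiv_real_comp hζ1 hu1]
  ring

omit [CompleteSpace E] in
/-- **The Hessian of a composite**: for `u` of class `C²` at `x` and `ζ` of class `C²` at `u x`,
`Hess(ζ ∘ u)_x(v, w) = ζ''(u x) du_x(v) du_x(w) + ζ'(u x) Hess u_x(v, w)` — both Hessians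
evaluate by the classical formula on the extensions of `v, w` (`hessian_apply_holds`), and that
formula obeys `hessianAux_real_comp`. O'Neill 1983, Ch. 3, Def. 3.48–Lemma 3.49.
[cite: ONeill1983, Ch. 3, Lemma 3.49] -/
theorem hessian_real_comp {u : M → ℝ} {ζ : ℝ → ℝ} {x : M} (hu : CMDiffAt 2 u x)
    (hζ : ContDiffAt ℝ 2 ζ (u x)) (v w : TangentSpace I x) :
    g.hessian (ζ ∘ u) x v w =
      deriv (deriv ζ) (u x) * (mvfderiv I u x v * mvfderiv I u x w)
        + deriv ζ (u x) * g.hessian u x v w := by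
  have hζu : CMDiffAt 2 (ζ ∘ u) x := (contMDiffAt_iff_contDiffAt.2 hζ).comp x hu
  set X : Π y : M, TangentSpace I y := FiberBundle.extend E v with hX
  set Y : Π y : M, TangentSpace I y := FiberBundle.extend E w with hY
  have hXd : MDiffAt (T% X) x := mdifferentiableAt_extend ..
  have hYd : MDiffAt (T% Y) x := mdifferentiableAt_extend ..
  have hv : X x = v := by rw [hX, FiberBundle.extend_apply_self]
  have hw : Y x = w := by rw [hY, FiberBundle.extend_apply_self]
  rw [← hv, ← hw, g.hessian_apply_holds hζu hXd hYd, g.hessian_apply_holds hu hXd hYd]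
  exact g.hessianAux_real_comp hu hζ X hYd

/-! ### The metric trace of a rank-one form -/

section Trace

variable {EB : Type*} [NormedAddCommGroup EB] [NormedSpace ℝ EB] {HB : Type*}
  [TopologicalSpace HB] {IB : ModelWithCorners ℝ EB HB} {n' : WithTop ℕ∞}
  {B : Type*} [TopologicalSpace B] [ChartedSpace HB B]
  {F' : Type*} [NormedAddCommGroup F'] [NormedSpace ℝ F']
  {V : B → Type*} [TopologicalSpace (Bundle.TotalSpace F' V)]
  [∀ b, TopologicalSpace (V b)] [∀ b, AddCommGroup (V b)] [∀ b, Module ℝ (V b)]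
  [FiberBundle F' V] [VectorBundle ℝ F' V] [FiniteDimensional ℝ F']

/-- **The metric trace of a rank-one form**: for covectors `α, β`, the form
`(v, w) ↦ α(v) β(w)` (`α.smulRight β`) has `tr_g = α(♯β) = g⁻¹(α, β)` (O'Neill 1983, Ch. 3,
pp. 60–61: `g^{ij} αᵢ βⱼ`). [cite: ONeill1983, Ch. 3, pp. 60–61] -/
theorem trace_smulRight_dual (g' : PseudoRiemannianMetric IB n' F' V) (b : B)
    (α β : Module.Dual ℝ (V b)) :
    g'.trace b (α.smulRight β) = g'.innerDual b α β := by
  haveI := VectorBundle.finiteDimensional ℝ F' V b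
  have h : (g'.sharp b).toLinearMap ∘ₗ (α.smulRight β) = α.smulRight (g'.sharp b β) := by
    ext v
    simp only [LinearMap.comp_apply, LinearMap.smulRight_apply, LinearEquiv.coe_coe, map_smul]
  rw [PseudoRiemannianMetric.trace, h, LinearMap.trace_smulRight]
  rfl

/-- **For a Riemannian metric the inverse metric is positive semidefinite**: `g⁻¹(α, α) ≥ 0`
(`g⁻¹(α, α) = g(♯α, ♯α)`). [folklore] -/
theorem innerDual_self_nonneg (g' : PseudoRiemannianMetric IB n' F' V) (hg : g'.IsRiemannian)
    (b : B) (α : Module.Dual ℝ (V b)) : 0 ≤ g'.innerDual b α α := by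
  rw [g'.innerDual_eq_val_sharp_sharp]
  by_cases h : g'.sharp b α = 0
  · rw [h]
    simp
  · exact (hg b _ h).le

end Trace

/-! ### The wave operator of a composite -/

omit [CompleteSpace E] in
/-- **The wave / Laplace–Beltrami operator of a composite.** For `u` of class `C²` at `x` and
`ζ : ℝ → ℝ` of class `C²` at `u x`,
`□_g(ζ ∘ u)(x) = ζ''(u x) g⁻¹_x(du, du) + ζ'(u x) □_g u (x)`:
the metric trace of `hessian_real_comp` (`tr_g` of the rank-one form `du ⊗ du` is
`g⁻¹(du, du) = |∇u|²_g`). O'Neill 1983, Ch. 3, Def. 3.50 with Lemma 3.49; this is the chain rule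
used in Schoen–Yau 1979, §2 Step 1, to see `Δφ ≤ 0` for `φ = 1 + ζ(−M/4r)` with `ζ` concave
nondecreasing ((2.2)–(2.3)). [cite: ONeill1983, Ch. 3, Def. 3.50] -/
theorem dalembertian_real_comp {u : M → ℝ} {ζ : ℝ → ℝ} {x : M} (hu : CMDiffAt 2 u x)
    (hζ : ContDiffAt ℝ 2 ζ (u x)) :
    g.dalembertian (ζ ∘ u) x =
      deriv (deriv ζ) (u x) *
          g.innerDual x (mvfderiv I u x).toLinearMap (mvfderiv I u x).toLinearMap
        + deriv ζ (u x) * g.dalembertian u x := by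
  have hH : g.hessian (ζ ∘ u) x =
      deriv (deriv ζ) (u x) •
          ((mvfderiv I u x).toLinearMap.smulRight (mvfderiv I u x).toLinearMap)
        + deriv ζ (u x) • g.hessian u x := by
    refine LinearMap.ext₂ fun v w ↦ ?_
    rw [g.hessian_real_comp hu hζ v w]
    simp only [LinearMap.add_apply, LinearMap.smul_apply, LinearMap.smulRight_apply,
      ContinuousLinearMap.coe_coe, smul_eq_mul]
  rw [dalembertian, hH, trace_add, trace_smul, trace_smul, trace_smulRight_dual, dalembertian]

omit [CompleteSpace E] in
/-- **Superharmonicity of a concave nondecreasing function of a superharmonic function** (the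
step (2.3) of Schoen–Yau 1979, §2 Step 1): for a Riemannian `g`, `u` of class `C²` at `x` with
`□_g u (x) ≤ 0`, and `ζ` of class `C²` at `u x` with `ζ'(u x) ≥ 0`, `ζ''(u x) ≤ 0`:
`□_g (ζ ∘ u)(x) ≤ 0`. [cite: SchoenYauPMT1979, §2 Step 1 (2.3)] -/
theorem dalembertian_real_comp_nonpos (hg : g.IsRiemannian) {u : M → ℝ} {ζ : ℝ → ℝ} {x : M}
    (hu : CMDiffAt 2 u x) (hζ : ContDiffAt ℝ 2 ζ (u x)) (hΔ : g.dalembertian u x ≤ 0)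
    (h1 : 0 ≤ deriv ζ (u x)) (h2 : deriv (deriv ζ) (u x) ≤ 0) :
    g.dalembertian (ζ ∘ u) x ≤ 0 := by
  rw [g.dalembertian_real_comp hu hζ]
  have hI := g.innerDual_self_nonneg hg x (mvfderiv I u x).toLinearMap
  have hA : 0 ≤ -deriv (deriv ζ) (u x) *
      g.innerDual x (mvfderiv I u x).toLinearMap (mvfderiv I u x).toLinearMap :=
    mul_nonneg (neg_nonneg.2 h2) hI
  have hB : 0 ≤ deriv ζ (u x) * -g.dalembertian u x := mul_nonneg h1 (neg_nonneg.2 hΔ)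
  linarith

end PseudoRiemannianMetric

end Literature.Geometry.Lorentzian

end
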